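import Summits.HubbardSuperconductivity.HubbardSuperconductivity.Theorems.AnisotropyChordTransferFibre3Hole2Bond

/-!
# Route `AnisotropyChord` / H0 rotor rung: HOLE₂(.75) channel checks — kernel facts for `55 ≤ L ≤ 63`

KERNEL FACTS (zero data): for each listed `L` the per-`L` channel checker `Hole2.chanCheck L` (`…Fibre3Hole2Bond`: g3's parameter
check + the enclosures of the three torus Green values `G̃_{g_L}(0,0), G̃_{g_L}(2,0), G̃_{g_L}(1,1)` by g3's `greenIv`, and the two
integer comparisons `2aKer(2,0) ≤ 1`, `4aKer(1,1) − 2aKer(2,0) ≤ 1` in walk units) returns `true`, by one `decide +kernel` each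
(`O(L²)` interval operations; `maxHeartbeats 400000` pre-budgeted as in g3's per-`L` files).  Soundness
(`Hole2.twoHoleGap_of_chanCheck : chanCheck L = true → TwoHoleGap L (3/4·eps1 L)`) is `…Fibre3Hole2Chan`; the ∀`L ≥ 9` assembly is
`…Fibre3Hole2AllL` (`9…36`: g3's kernel certificates; `37…63`: these facts; `≥ 64`: analytic, `…Fibre3Hole2Large`).
Prover seat `hubbard-h0-rotor-p3` g4; helper for stmt-HubbardSuperconductivity-19089 (`--supports`, helper class).
WHAT THIS IS NOT: nothing here proves superconductivity in the Hubbard model (rotor TARGET as worded stays FALSE, g15 verdict);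
kernel facts for ONE input (HOLE₂(.75)) of ONE conditional reduction (rung 19089). Tree imports only; no sorry, no `native_decide`.
-/

set_option linter.dupNamespace false
set_option autoImplicit false

namespace Summit.HubbardSuperconductivity.HubbardSuperconductivity.Theorems.AnisotropyChord.Transfer.Fibre3

namespace Hole2

set_option maxHeartbeats 400000 in
/-- kernel fact: the channel check passes at `L = 55` (`2aKer(2,0) ≤ 1`, `4aKer(1,1) − 2aKer(2,0) ≤ 1` at `g_55 ≥ ¾ε₁(55)`). [folklore] -/
theorem chanCheck_55 : chanCheck 55 = true := by
  decide +kernel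

set_option maxHeartbeats 400000 in
/-- kernel fact: the channel check passes at `L = 56` (`2aKer(2,0) ≤ 1`, `4aKer(1,1) − 2aKer(2,0) ≤ 1` at `g_56 ≥ ¾ε₁(56)`). [folklore] -/
theorem chanCheck_56 : chanCheck 56 = true := by
  decide +kernel

set_option maxHeartbeats 400000 in
/-- kernel fact: the channel check passes at `L = 57` (`2aKer(2,0) ≤ 1`, `4aKer(1,1) − 2aKer(2,0) ≤ 1` at `g_57 ≥ ¾ε₁(57)`). [folklore] -/
theorem chanCheck_57 : chanCheck 57 = true := by
  decide +kernel

set_option maxHeartbeats 400000 in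
/-- kernel fact: the channel check passes at `L = 58` (`2aKer(2,0) ≤ 1`, `4aKer(1,1) − 2aKer(2,0) ≤ 1` at `g_58 ≥ ¾ε₁(58)`). [folklore] -/
theorem chanCheck_58 : chanCheck 58 = true := by
  decide +kernel

set_option maxHeartbeats 400000 in
/-- kernel fact: the channel check passes at `L = 59` (`2aKer(2,0) ≤ 1`, `4aKer(1,1) − 2aKer(2,0) ≤ 1` at `g_59 ≥ ¾ε₁(59)`). [folklore] -/
theorem chanCheck_59 : chanCheck 59 = true := by
  decide +kernel

set_option maxHeartbeats 400000 in
/-- kernel fact: the channel check passes at `L = 60` (`2aKer(2,0) ≤ 1`, `4aKer(1,1) − 2aKer(2,0) ≤ 1` at `g_60 ≥ ¾ε₁(60)`). [folklore] -/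
theorem chanCheck_60 : chanCheck 60 = true := by
  decide +kernel

set_option maxHeartbeats 400000 in
/-- kernel fact: the channel check passes at `L = 61` (`2aKer(2,0) ≤ 1`, `4aKer(1,1) − 2aKer(2,0) ≤ 1` at `g_61 ≥ ¾ε₁(61)`). [folklore] -/
theorem chanCheck_61 : chanCheck 61 = true := by
  decide +kernel

set_option maxHeartbeats 400000 in
/-- kernel fact: the channel check passes at `L = 62` (`2aKer(2,0) ≤ 1`, `4aKer(1,1) − 2aKer(2,0) ≤ 1` at `g_62 ≥ ¾ε₁(62)`). [folklore] -/
theorem chanCheck_62 : chanCheck 62 = true := by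
  decide +kernel

set_option maxHeartbeats 400000 in
/-- kernel fact: the channel check passes at `L = 63` (`2aKer(2,0) ≤ 1`, `4aKer(1,1) − 2aKer(2,0) ≤ 1` at `g_63 ≥ ¾ε₁(63)`). [folklore] -/
theorem chanCheck_63 : chanCheck 63 = true := by
  decide +kernel

end Hole2

end Summit.HubbardSuperconductivity.HubbardSuperconductivity.Theorems.AnisotropyChord.Transfer.Fibre3
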